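import Summits.CriticalPhenomena.PercolationContinuityZ3.Theorems.Transplant.FKConnectivityAllQSPReroot
import HarnessLib

/-!
# Connectivity correlation inequalities for `φ_{w,q}`, every `q > 0` — file 18: the `q`-uniform theorems at EVERY pair of edges of a
# completed two-terminal series–parallel support, and Wagner's theorem in the shape of the named fact

Support file (`--supports stmt-CriticalPhenomena-4575`), FK sub-lane `prim-bschramm-fk-2` (gen 7) of the post-continuity
programme; builds on p205010 (kernel theorem, internal audit signed; external expert review pending).  No definitions, no named
facts, no sorries; standard axioms.  Corollaries of the re-rooting `FK.IsTTSP.insert_edge_of_mem` (`…AllQSPReroot.lean`): for a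
two-terminal series–parallel network `E` between `s, t`, the completed support `S = E ∪ {st}` (a 2-connected series–parallel graph
presented from one of its edges) and a weight vector `w` supported in `S`:
* `FK.rcMeasureW_real_openConn_mono_of_isTTSP_mem` — for every edge `xy ∈ S` and every `q > 0`, `φ_{w,q}(x ↔ y)` is non-decreasing in
  every parameter (`w ≤ w'` supported in `S`);
* `FK.pairConnPosUnder_of_isTTSP_mem`, `FK.hubUnder_of_isTTSP_mem` — for every two edges `xy, uv ∈ S` (resp. `oa, ba ∈ S`) and every
  `q > 0`, `φ(x↔y)φ(u↔v) ≤ φ(x↔y, u↔v)` (resp. ALR's hub inequality (13)) — the all-`q` companions of fk-1 g5's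
  `FK.pairConnPosUnder_of_isTwoTree` / `FK.hubUnder_of_isTwoTree` (`q < 1`, 2-tree supports);
* `FK.rc_edgeNegCorr_of_isTTSP` — Wagner 2008 (graph case) in the exact binder shape of the named fact
  `Wagner2008_rc_edgeNegCorr_of_noK4Minor` (`Fin n`, `0 < q ≤ 1`, all pairs `e ≠ f`, `e` not a loop) with the hypothesis
  '`supp(w)` has no `K₄` minor' replaced by '`supp(w) ⊆ E ∪ {st}` for some two-terminal series–parallel network `E` between `s, t`' (support hypothesis
  written instance-free as `w e ≠ 0 → e = st ∨ e ∈ E`; equivalent for 2-connected supports by Duffin 1965 / Dirac 1952, not formalised).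
[cite: Wagner2006, Ex. 5.1, Thm. 5.8(d), §5.3] [cite: AyyerLinussonRavichandran2025, §7 eq. (13) (p. 22)] [cite: Grimmett2006, Thm. (3.21); §3.9 eq. (3.94)]
-/

noncomputable section

namespace Summit.CriticalPhenomena.PercolationContinuityZ3.Theorems

namespace FK

open MeasureTheory Literature.Probability.LatticeModels Literature.Probability.Percolation
open scoped Classical

variable {V : Type*} [Fintype V] {q : ℝ} {E : Finset (Sym2 V)} {s t : V}

/-- **Monotonicity in the parameters at every edge of a completed TTSP support, every `q > 0`.**
[cite: Grimmett2006, Thm. (3.21) (p. 43); §3.9 (p. 63)] [cite: Wagner2006, §5.3] -/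
theorem rcMeasureW_real_openConn_mono_of_isTTSP_mem (hq : 0 < q) (hE : IsTTSP E s t) {x y : V}
    (hxy : s(x, y) ∈ insert s(s, t) E) {w w' : Sym2 V → unitInterval} (hww : ∀ e, w e ≤ w' e)
    (hw' : ∀ e, ((w' e : unitInterval) : ℝ) ≠ 0 → e ∈ (↑(insert s(s, t) E) : Set (Sym2 V))) :
    (rcMeasureW w q ∅).real (openConn x y) ≤ (rcMeasureW w' q ∅).real (openConn x y) :=
  rcMeasureW_real_openConn_mono_of_isTTSP hq (hE.insert_edge_of_mem hxy) hww hw'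

/-- **Pairwise positive correlation of the connection events of two edges of a completed TTSP support, every `q > 0`.**
[cite: AyyerLinussonRavichandran2025, §7 eq. (13)–(15) (p. 22)] [cite: Wagner2006, §5.3] -/
theorem pairConnPosUnder_of_isTTSP_mem (hq : 0 < q) (hE : IsTTSP E s t) {x y u v : V} (hxy : s(x, y) ∈ insert s(s, t) E)
    (huv : s(u, v) ∈ insert s(s, t) E) (w : Sym2 V → unitInterval)
    (hw : ∀ e, ((w e : unitInterval) : ℝ) ≠ 0 → e ∈ (↑(insert s(s, t) E) : Set (Sym2 V))) :
    PairConnPosUnder (rcMeasureW w q ∅) x y u v :=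
  pairConnPosUnder_of_isTTSP hq (hE.insert_edge_of_mem hxy) (hE.insert_edge_of_mem huv) w hw

/-- **The hub inequality at two edges `oa, ba` of a completed TTSP support, every `q > 0`** (ALR 2025 (13)).
[cite: AyyerLinussonRavichandran2025, §7 eq. (13), Conj. 7.1 (p. 22)] [cite: Wagner2006, §5.3] -/
theorem hubUnder_of_isTTSP_mem (hq : 0 < q) (hE : IsTTSP E s t) {o a b : V} (hoa : s(o, a) ∈ insert s(s, t) E)
    (hba : s(b, a) ∈ insert s(s, t) E) (w : Sym2 V → unitInterval)
    (hw : ∀ e, ((w e : unitInterval) : ℝ) ≠ 0 → e ∈ (↑(insert s(s, t) E) : Set (Sym2 V))) :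
    HubUnder (rcMeasureW w q ∅) o a b :=
  hubUnder_of_pairConnPosUnder _ o a b (pairConnPosUnder_of_isTTSP_mem hq hE hoa hba w hw)

omit [Fintype V] in
/-- **Wagner 2008, graph case, in the shape of the named fact** `Wagner2008_rc_edgeNegCorr_of_noK4Minor`: for `0 < q ≤ 1` and every weight
vector on `Fin n` supported in a completed two-terminal series–parallel network `E ∪ {st}`, `φ_{w,q}(J_e ∩ J_f) ≤ φ_{w,q}(J_e)·φ_{w,q}(J_f)` for
all pairs `f ≠ e`, `e` not a loop.  UNCONDITIONAL; the named fact itself additionally needs 'no `K₄` minor ⇒ such a presentation of each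
block' (Dirac 1952 / Duffin 1965). [cite: Wagner2006, Ex. 5.1, Thm. 5.8(d), §5.2, §5.3] [cite: Grimmett2006, §3.9 eq. (3.94) (pp. 63–64)] -/
theorem rc_edgeNegCorr_of_isTTSP :
    ∀ (n : ℕ) (w : Sym2 (Fin n) → unitInterval) (q : ℝ), 0 < q → q ≤ 1 →
      (∃ (E : Finset (Sym2 (Fin n))) (s t : Fin n), IsTTSP E s t ∧
        ∀ e : Sym2 (Fin n), ((w e : unitInterval) : ℝ) ≠ 0 → e = s(s, t) ∨ e ∈ E) →
      ∀ e f : Sym2 (Fin n), ¬ e.IsDiag → f ≠ e →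
        (rcMeasureW w q ∅).real ({ω | e ∈ ω} ∩ {ω | f ∈ ω}) ≤
          (rcMeasureW w q ∅).real {ω | e ∈ ω} * (rcMeasureW w q ∅).real {ω | f ∈ ω} := by
  intro n w q hq0 hq1 hE e f he hfe
  obtain ⟨E, s, t, hE, hw⟩ := hE
  -- the support hypothesis of the generic theorem is membership in `insert st E` built with the classical `DecidableEq`
  -- (the only one available for a general vertex type); supply that instance explicitly
  exact edgeNegCorr_supp_of_isTTSP_of_le_one hq0 hq1 hE w
    (fun g hg => Finset.mem_coe.2
      ((@Finset.mem_insert (Sym2 (Fin n)) (@Sym2.instDecidableEq (Fin n) fun a b => Classical.propDecidable (a = b))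
        E g s(s, t)).2 (hw g hg))) e f he hfe

end FK

end Summit.CriticalPhenomena.PercolationContinuityZ3.Theorems

end
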